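import Mathlib.Topology.MetricSpace.Thickening
import Mathlib.Analysis.Calculus.Gradient.Basic
import Mathlib.Analysis.Calculus.Deriv.Comp
import Mathlib.Analysis.Calculus.Deriv.Pow
import Literature.Analysis.FluidPDE.AxisymmetricEuler
import Literature.Analysis.FluidPDE.WholeSpaceIBP
import HarnessLib

/-!
# Gavrilov's smooth compactly supported steady Euler flow on `ℝ³`

Topic `Literature/Analysis/FluidPDE`; a NAMED FACT (result in print, `def … : Prop`, D-0014)
requested by route `AdiabaticEddy` of `NavierStokesRegularity` (items `CorrectorSolvable` =
`stmt-NavierStokesRegularity-1429`, `ChiralEddyExists` = `…-1432`, whose statements quantify over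
"a nonzero smooth compactly supported steady Euler flow `U`": `ContDiff ℝ ∞ U ∧ ContDiff ℝ ∞ P ∧
HasCompactSupport U ∧ U ≠ 0 ∧ IsDivFree U ∧ ∀ x, (U·∇)U x + ∇P x = 0`) and by the idea card
`euler-equilibria-tokamak-quasistatics`, plus the elementary, fully PROVED "localisation"
(modulation) identities behind it.

**Gavrilov's theorem** (GAFA 29 (2019), §1, Theorem): *there exists a nontrivial smooth steady
Euler flow in `ℝ³` with support in an arbitrarily small neighbourhood of a circle.* The flow
constructed in §3 is axisymmetric (with swirl `b e_φ`, `b = ¼R³√H(a) > 0` on the support), is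
obtained from an analytic local solution `(u, p)` near the circle `𝒞 = {ρ = R, z = 0}` (any
`R > 0`; §3, the display defining `p = ¼aR⁴`, `b`, `u`) enjoying the extra property
`u·∇p = 0` (pressure constant along streamlines), by the modulation `ũ = ω(p) u`,
`dp̃ = ω²(p) dp` with a cutoff `ω` supported in `p ∈ [ε, 2ε]`
(§3, last paragraph; the strict minimum of `p` on `𝒞`, Lemma 4, makes `ũ ∈ C^∞(ℝ³)` with support
in a thin toroidal shell around `𝒞`); the modulated flow keeps `ũ·∇p̃ = 0` and `|ũ|²` a function
of `p̃` (§4, "generalized Beltrami flows"). Constantin–La–Vicol (GAFA 29 (2019), Thm 1.1 and §§2–3)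
re-derive the result from a *localizable Grad–Shafranov* system; neither construction is explicit in
closed form (both rest on analytic solutions of singular nonlinear ODEs: Gavrilov's Lemma 1,
CLV's ODEs for `a(φ), b(φ)` in §3), which is why the existence statement is vendored as a named
fact and not (yet) as a theorem.

## Contents

* `gavrilov_compact_steady_euler` — the named fact, as printed plus the printed structural
  properties of the constructed flow (every radius `R > 0` and every `δ`-neighbourhood of the
  circle; `C^∞`; compact support of `U` and — after normalising the additive constant — of `P`;
  `U ≠ 0`; axisymmetric velocity and pressure; nonzero swirl; `div U = 0`; `(U·∇)U + ∇P = 0`;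
  `U·∇P = 0`).
* `gavrilov_compact_steady_euler.exists_ne_zero` — the consumer shape of route `AdiabaticEddy`
  (literally the `∃ U P, …` block of `CorrectorSolvable` / `FrozenEddyCollapse`), PROVED from
  the fact; `….exists_orthogonal` keeps `HasCompactSupport P` and `U·∇P = 0`.
* The **localisation identities** (Gavrilov 2019, §3, the two displays `div ũ = …`,
  `(ũ·∇)ũ = …`; Constantin–La–Vicol 2019, §2, displays `ũ = φ(p)u`, `p̃ = ∫φ²(p)dp`), PROVED
  pointwise on any finite-dimensional real inner product space: if `Dp(x)[u x] = 0` then for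
  `ũ = φ(p) u`, `p̃ = Φ(p)` with `Φ' = φ²`,
  `div ũ = φ(p) div u` (`Gavrilov.divergence_modulate`),
  `(ũ·∇)ũ + ∇p̃ = φ(p)² ((u·∇)u + ∇p)` (`Gavrilov.convect_modulate_add_gradient`) and
  `ũ·∇p̃ = 0` (`Gavrilov.fderiv_modulate_apply`); bundled as `Gavrilov.steadyEuler_modulate`.

## Rendering choices

* Smoothness is `ContDiff ℝ ∞` (`(⊤ : ℕ∞)`, NOT analytic: the flow is compactly supported).
* "steady Euler flow" = the pointwise classical system in the tree's vocabulary
  (`VectorCalculus.IsDivFree`, `convect U U x + gradient P x = 0`), exactly as the consumers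
  write it.
* The circle is `{x | cylRadius x = R ∧ x 2 = 0}` (axis = the `x 2`-axis, as in
  `AxisymmetricEuler.lean`); "support in an arbitrarily small neighbourhood" =
  `tsupport U ⊆ Metric.thickening δ (circle)` for every `δ > 0`.
* The pressure of a steady flow is determined up to an additive constant; Gavrilov's `p̃`
  (`dp̃ = ω²(p)dp`) is locally constant off the toroidal shell `supp ũ`, with one value inside and
  one outside; we normalise the outside value to `0`, whence `HasCompactSupport P`.
* `U·∇P = 0` is `convect U P x = 0` (`convect U P x = DP(x)[U x]`, `VectorCalculus.lean`).

## Mathlib / tree search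

Mathlib (this pin) has no Euler-equation, Grad–Shafranov or steady-flow notions (`lean search`
"Gavrilov", "GradShafranov", "steady Euler": only our own route/idea texts). Tree vocabulary used:
`VectorCalculus.divergence/IsDivFree`, `convect` (`VectorCalculus.lean`), `IsAxisymmetric`,
`IsAxisymmetricScalar`, `HasNoSwirl`, `cylRadius` (`AxisymmetricEuler.lean`),
`divergence_smul_apply`, `convect_smul_apply` (`WholeSpaceIBP.lean`),
`inner_gradient_eq_fderiv_apply`-style unfolding of `gradient`.

## References

* A. V. Gavrilov, *A steady Euler flow with compact support*, Geom. Funct. Anal. 29 (2019)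
  190–197, arXiv:1810.08020: §1 Theorem; §2 Lemmas 1–4; §3 (the ansatz `p = ¼aR⁴`,
  `u = ρ⁻¹(∂_z p e_ρ − ∂_ρ p e_z + b e_φ)`, the lemma following it, and the modulation
  `ũ = ω(p)u`); §4. [`Gavrilov2019`]
* P. Constantin, J. La, V. Vicol, *Remarks on a paper by Gavrilov: Grad–Shafranov equations,
  steady solutions of the three dimensional incompressible Euler equations with compactly supported
  velocities, and applications*, Geom. Funct. Anal. 29 (2019) 1773–1793, arXiv:1903.11699:
  Thm 1.1 (Gavrilov's theorem), §2 (Grad–Shafranov ansatz, localisation `ũ = φ(p)u`,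
  `p̃ = ∫φ²`), §3 (construction; Theorem on the localizable Grad–Shafranov system).
  [`ConstantinLaVicol2019`]
-/

noncomputable section

open Set Metric
open scoped RealInnerProductSpace

namespace Literature.Analysis.FluidPDE

local notation "ℝ³" => EuclideanSpace ℝ (Fin 3)

/-! ### The named fact -/

/-- **Gavrilov's compactly supported steady Euler flow** (Gavrilov 2019, §1 Theorem: "There exists
a nontrivial smooth steady Euler flow in `ℝ³` with support in an arbitrarily small neighbourhood of
a circle"; construction of §3: for every `R > 0`, around the circle `𝒞 = {ρ = R, z = 0}`, the
axisymmetric flow `u = ρ⁻¹(∂_z p e_ρ − ∂_ρ p e_z + b e_φ)`, `p = ¼aR⁴`, `b = ¼R³√H(a)`, modulated to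
`ũ = ω(p)u`, `dp̃ = ω(p)²dp`, which is `C^∞` on `ℝ³`, supported in a toroidal shell arbitrarily
close to `𝒞`, divergence free, solves `(ũ·∇)ũ = −∇p̃`, and satisfies `ũ·∇p̃ = 0` (§3–§4); also
Constantin–La–Vicol 2019, Thm 1.1). Rendered: for every radius `R > 0` and every `δ > 0` there are
`U : ℝ³ → ℝ³`, `P : ℝ³ → ℝ`, both `C^∞` with compact support (the pressure normalised to vanish
outside the shell), `U ≠ 0`, `tsupport U` inside the `δ`-neighbourhood of the circle
`{cylRadius x = R, x₂ = 0}`, `U` axisymmetric with nonzero swirl and `P` axisymmetric,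
`div U = 0`, `(U·∇)U + ∇P = 0` and `U·∇P = 0` pointwise. Not proved here (the construction rests on
analytic solutions of singular nonlinear ODE/PDE systems, Gavrilov's Lemmas 1 and 3).
[cite: Gavrilov2019, §1 Theorem and §3] -/
def gavrilov_compact_steady_euler : Prop :=
  ∀ R : ℝ, 0 < R → ∀ δ : ℝ, 0 < δ →
    ∃ (U : ℝ³ → ℝ³) (P : ℝ³ → ℝ),
      ContDiff ℝ (⊤ : ℕ∞) U ∧ ContDiff ℝ (⊤ : ℕ∞) P ∧ HasCompactSupport U ∧ HasCompactSupport P ∧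
      U ≠ 0 ∧ tsupport U ⊆ Metric.thickening δ {x : ℝ³ | cylRadius x = R ∧ x 2 = 0} ∧
      IsAxisymmetric U ∧ IsAxisymmetricScalar P ∧ ¬ HasNoSwirl U ∧
      VectorCalculus.IsDivFree U ∧ (∀ x, convect U U x + gradient P x = 0) ∧
      (∀ x, convect U P x = 0)

/-- **Consumer shape** (route `AdiabaticEddy`, the `∃ U P, …` block of `CorrectorSolvable` /
`FrozenEddyCollapse`): a nonzero `C^∞` compactly supported divergence-free `U` and a `C^∞`
pressure `P` with `(U·∇)U + ∇P = 0` on `ℝ³`, from Gavrilov's theorem (take `R = δ = 1` and forget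
the extra structure). [cite: Gavrilov2019, §1 Theorem] -/
theorem gavrilov_compact_steady_euler.exists_ne_zero (h : gavrilov_compact_steady_euler) :
    ∃ (U : ℝ³ → ℝ³) (P : ℝ³ → ℝ), ContDiff ℝ (⊤ : ℕ∞) U ∧ ContDiff ℝ (⊤ : ℕ∞) P ∧
      HasCompactSupport U ∧ U ≠ 0 ∧ VectorCalculus.IsDivFree U ∧
      ∀ x, convect U U x + gradient P x = 0 := by
  obtain ⟨U, P, hU, hP, hUc, -, hU0, -, -, -, -, hdiv, hE, -⟩ := h 1 one_pos 1 one_pos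
  exact ⟨U, P, hU, hP, hUc, hU0, hdiv, hE⟩

/-- The same consumer shape keeping the compactly supported pressure and Gavrilov's orthogonality
`U·∇P = 0` (Gavrilov 2019, §4). [cite: Gavrilov2019, §4] -/
theorem gavrilov_compact_steady_euler.exists_orthogonal (h : gavrilov_compact_steady_euler) :
    ∃ (U : ℝ³ → ℝ³) (P : ℝ³ → ℝ), ContDiff ℝ (⊤ : ℕ∞) U ∧ ContDiff ℝ (⊤ : ℕ∞) P ∧
      HasCompactSupport U ∧ HasCompactSupport P ∧ U ≠ 0 ∧ VectorCalculus.IsDivFree U ∧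
      (∀ x, convect U U x + gradient P x = 0) ∧ (∀ x, convect U P x = 0) := by
  obtain ⟨U, P, hU, hP, hUc, hPc, hU0, -, -, -, -, hdiv, hE, horth⟩ := h 1 one_pos 1 one_pos
  exact ⟨U, P, hU, hP, hUc, hPc, hU0, hdiv, hE, horth⟩

/-! ### The localisation (modulation) identities — proved -/

namespace Gavrilov

variable {E : Type*} [NormedAddCommGroup E] [InnerProductSpace ℝ E] [FiniteDimensional ℝ E]

omit [FiniteDimensional ℝ E] in
/-- Chain rule for the modulating factor: `D(φ ∘ p)(x) = φ'(p x) • Dp(x)`. [folklore] -/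
theorem hasFDerivAt_comp_scalar {p : E → ℝ} {φ : ℝ → ℝ} {φ' : ℝ} {x : E}
    (hp : DifferentiableAt ℝ p x) (hφ : HasDerivAt φ φ' (p x)) :
    HasFDerivAt (fun y => φ (p y)) (φ' • fderiv ℝ p x) x :=
  hφ.comp_hasFDerivAt x hp.hasFDerivAt

/-- Gradient chain rule: `∇(Φ ∘ p)(x) = Φ'(p x) • ∇p(x)`. [folklore] -/
theorem gradient_comp_scalar {p : E → ℝ} {Φ : ℝ → ℝ} {Φ' : ℝ} {x : E}
    (hp : DifferentiableAt ℝ p x) (hΦ : HasDerivAt Φ Φ' (p x)) :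
    gradient (fun y => Φ (p y)) x = Φ' • gradient p x := by
  haveI : CompleteSpace E := FiniteDimensional.complete ℝ E
  rw [gradient, gradient, (hasFDerivAt_comp_scalar hp hΦ).fderiv, map_smul]

/-- **Modulation preserves incompressibility** (Gavrilov 2019, §3: `div ũ = ω(p) div u +
ω'(p)(u·∇p) = ω(p) div u`; Constantin–La–Vicol 2019, §2): if `Dp(x)[u x] = 0` then
`div (φ(p) u)(x) = φ(p x) · div u (x)`. [cite: Gavrilov2019, §3 (display `div ũ = …`)] -/
theorem divergence_modulate {u : E → E} {p : E → ℝ} {φ : ℝ → ℝ} {x : E}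
    (hu : DifferentiableAt ℝ u x) (hp : DifferentiableAt ℝ p x)
    (hφ : DifferentiableAt ℝ φ (p x)) (horth : fderiv ℝ p x (u x) = 0) :
    VectorCalculus.divergence (fun y => φ (p y) • u y) x =
      φ (p x) * VectorCalculus.divergence u x := by
  haveI : CompleteSpace E := FiniteDimensional.complete ℝ E
  have hc : DifferentiableAt ℝ (fun y => φ (p y)) x :=
    (hasFDerivAt_comp_scalar hp hφ.hasDerivAt).differentiableAt
  rw [divergence_smul_apply hc hu, gradient, real_inner_comm, InnerProductSpace.toDual_symm_apply,
    (hasFDerivAt_comp_scalar hp hφ.hasDerivAt).fderiv, _root_.FunLike.coe_smul,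
    Pi.smul_apply, horth, smul_zero, add_zero]

/-- **Modulation preserves the momentum balance** (Gavrilov 2019, §3: `(ũ·∇)ũ = ω²(p)(u·∇)u +
ω(p)ω'(p)(u·∇p)u = −ω²(p)∇p` when `(u·∇)u = −∇p`; Constantin–La–Vicol 2019, §2): if
`Dp(x)[u x] = 0` and `Φ' (p x) = φ(p x)²` then
`(ũ·∇)ũ (x) + ∇(Φ∘p)(x) = φ(p x)² • ((u·∇)u (x) + ∇p (x))` for `ũ = φ(p) u`.
[cite: Gavrilov2019, §3 (display `(ũ·∇)ũ = …`)] -/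
theorem convect_modulate_add_gradient {u : E → E} {p : E → ℝ} {φ Φ : ℝ → ℝ} {x : E}
    (hu : DifferentiableAt ℝ u x) (hp : DifferentiableAt ℝ p x)
    (hφ : DifferentiableAt ℝ φ (p x)) (hΦ : HasDerivAt Φ (φ (p x) ^ 2) (p x))
    (horth : fderiv ℝ p x (u x) = 0) :
    convect (fun y => φ (p y) • u y) (fun y => φ (p y) • u y) x + gradient (fun y => Φ (p y)) x =
      φ (p x) ^ 2 • (convect u u x + gradient p x) := by
  have hc : DifferentiableAt ℝ (fun y => φ (p y)) x :=
    (hasFDerivAt_comp_scalar hp hφ.hasDerivAt).differentiableAt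
  rw [convect_smul_apply hc hu, gradient_comp_scalar hp hΦ,
    (hasFDerivAt_comp_scalar hp hφ.hasDerivAt).fderiv]
  simp only [convect, _root_.FunLike.coe_smul, Pi.smul_apply, map_smul, horth, smul_eq_mul,
    mul_zero, zero_smul, add_zero, smul_add, smul_smul, sq]

omit [FiniteDimensional ℝ E] in
/-- **Modulation preserves the orthogonality** `ũ·∇p̃ = 0` (Gavrilov 2019, §4: for the modified
flow `|ũ|²` is still a function of `p̃`; directly `D(Φ∘p)(x)[φ(p x) u x] = Φ'(p x) φ(p x) Dp(x)[u x]
= 0`). [cite: Gavrilov2019, §4] -/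
theorem fderiv_modulate_apply {u : E → E} {p : E → ℝ} {φ Φ : ℝ → ℝ} {Φ' : ℝ} {x : E}
    (hp : DifferentiableAt ℝ p x) (hΦ : HasDerivAt Φ Φ' (p x)) (horth : fderiv ℝ p x (u x) = 0) :
    fderiv ℝ (fun y => Φ (p y)) x (φ (p x) • u x) = 0 := by
  rw [(hasFDerivAt_comp_scalar hp hΦ).fderiv]
  simp [horth]

/-- **Gavrilov's localisation principle, bundled** (Gavrilov 2019, §3, "regardless of a choice of
the function `ω`, the field `ũ` is also an Euler flow, with the corresponding pressure determined by
`dp̃ = ω²(p)dp`"; Constantin–La–Vicol 2019, §2): let `u, p` be differentiable at `x`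
with `div u (x) = 0`, `(u·∇)u (x) + ∇p (x) = 0` and `Dp(x)[u x] = 0`; let `φ` be differentiable at
`p x` and `Φ' (p x) = φ(p x)²`. Then `ũ = φ(p)u`, `p̃ = Φ(p)` satisfy at `x`: `div ũ = 0`,
`(ũ·∇)ũ + ∇p̃ = 0` and `Dp̃(x)[ũ x] = 0`. [cite: Gavrilov2019, §3 (localisation `ũ = ω(p)u`)] -/
theorem steadyEuler_modulate {u : E → E} {p : E → ℝ} {φ Φ : ℝ → ℝ} {x : E}
    (hu : DifferentiableAt ℝ u x) (hp : DifferentiableAt ℝ p x)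
    (hφ : DifferentiableAt ℝ φ (p x)) (hΦ : HasDerivAt Φ (φ (p x) ^ 2) (p x))
    (hdiv : VectorCalculus.divergence u x = 0) (hE : convect u u x + gradient p x = 0)
    (horth : fderiv ℝ p x (u x) = 0) :
    VectorCalculus.divergence (fun y => φ (p y) • u y) x = 0 ∧
      convect (fun y => φ (p y) • u y) (fun y => φ (p y) • u y) x +
          gradient (fun y => Φ (p y)) x = 0 ∧
      fderiv ℝ (fun y => Φ (p y)) x (φ (p x) • u x) = 0 :=
  ⟨by rw [divergence_modulate hu hp hφ horth, hdiv, mul_zero],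
    by rw [convect_modulate_add_gradient hu hp hφ hΦ horth, hE, smul_zero],
    fderiv_modulate_apply hp hΦ horth⟩

end Gavrilov

end Literature.Analysis.FluidPDE
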